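import Mathlib
import Summits.NavierStokesRegularity.NavierStokesRegularity.Theorems.EulerZoomLiouvillePowerGaugeEulerLiouvilleAllRhoStrata
import Literature.Analysis.FluidPDE.PoincareHomotopyOperatorL2
import HarnessLib

/-!
# Log-time breathers EXPANDING INTO THE PAST are trivial in the power-gauged class (the `A`-gauge alone)
# (crux `EulerZoomLiouville.PowerGaugeEulerLiouville` = stmt-NavierStokesRegularity-19832; line `logtime-breathers` of ns-idea-11, stub T2a
# `stub_pastExpandingBreather` — member-level filler)

Route `EulerZoomLiouville` (NavierStokesRegularity); width seat ns-ezl-w1 on the interim LEAD ns-typeII-p2 g10's width offer (2026-08-28T05:15:59Z).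
A LOG-TIME BREATHER with rate `c' ≠ 0` and profile `V` is a member with `u(τ, y) = e^{c'τ} V(e^{−c'τ} y)` for all `τ < 0` (the `α = −1`
endpoint of Euler's scaling family).  For `c' < 0` (the breather EXPANDS into the past) the `A`-gauge `a^{2ρ} A(a; 0) ≤ c` alone kills it:
the slice energy scales as `∫_{B_a}|u(τ)|² = e^{5c'τ} ∫_{B_{e^{−c'τ}a}}|V|²`, and along `a = R e^{c'τ}`, `τ → −∞` (admissible: `τ > −a²`
because `R² e^{2c'τ}|c'| > c'τ` eventually), the gauge gives `∫_{B_R}|V|² ≤ c R^{1−2ρ} e^{−(4+2ρ)c'τ} → 0`.  Hence `∫_{B_R}‖V‖² = 0` for every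
`R`, every slice has zero energy, the past is energy-quiescent, and the crux's filled stratum `ae_eq_zero_of_gauge_of_energyVanishing_allRho`
concludes — with NO measurability hypothesis on `V` (lower integrals only; countable subadditivity over balls).

* `LogtimeBreather.lintegral_ball_enorm_sq_breatherSlice` — the slice scaling identity;
* `LogtimeBreather.lintegral_ball_profile_eq_zero_of_gaugeA` — `c' < 0` + `A`-gauge ⇒ `∫_{B_R}‖V‖ₑ² = 0` for all `R > 0`;
* `LogtimeBreather.ae_eq_zero_of_gauge_of_pastExpandingBreather` — MEMBER LEVEL, crux hypotheses verbatim (any `ρ ≥ 0`) + `c' < 0` +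
  the breather identity ⇒ `u = 0` a.e. on `(−∞,0) × ℝ³` (the line's `Sig.stub_pastExpandingBreather` with `InClass` / `IsLogtimeBreather` /
  `VanishesAE` unfolded — Theorems files do not import Cruxes; the LEAD wires it by name).

WHAT THIS IS NOT: not NS, not E, not the line's core (T2b, tame breathers with `c' > 0`) — one S/M stratum `--supports` stmt-19832. [folklore]
-/

noncomputable section

-- flat `Theorems/<Route><Decl>…` files of one crux share the namespace of the crux (tree convention: `Summit.<S>.<S>.…`)
set_option linter.dupNamespace false

open MeasureTheory Set Filter Topology Metric Function TopologicalSpace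
open scoped ENNReal NNReal

namespace Summit.NavierStokesRegularity.NavierStokesRegularity.Theorems.PowerGaugeEulerLiouville

open Literature.Analysis Literature.Analysis.FunctionSpaces Literature.Analysis.FluidPDE

namespace LogtimeBreather

/-! ### Slice scaling of a breather -/

/-- **Ball energies of a breather slice.**  `∫_{B_a} ‖e^{cτ} V(e^{−cτ} y)‖² dy = e^{5cτ} ∫_{B_{e^{−cτ} a}} ‖V‖²` (amplitude `e^{2cτ}`, Jacobian
`e^{3cτ}`), as lower integrals (no measurability). [folklore] -/
theorem lintegral_ball_enorm_sq_breatherSlice (c τ : ℝ)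
    (V : EuclideanSpace ℝ (Fin 3) → EuclideanSpace ℝ (Fin 3)) (a : ℝ) :
    ∫⁻ y in ball (0 : EuclideanSpace ℝ (Fin 3)) a, ‖Real.exp (c * τ) • V (Real.exp (-(c * τ)) • y)‖ₑ ^ 2 =
      ENNReal.ofReal (Real.exp (5 * (c * τ))) *
        ∫⁻ x in ball (0 : EuclideanSpace ℝ (Fin 3)) (Real.exp (-(c * τ)) * a), ‖V x‖ₑ ^ 2 := by
  have hm : 0 < Real.exp (c * τ) := Real.exp_pos _
  have hd : 0 < Real.exp (-(c * τ)) := Real.exp_pos _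
  have h1 : ∀ y : EuclideanSpace ℝ (Fin 3), ‖Real.exp (c * τ) • V (Real.exp (-(c * τ)) • y)‖ₑ ^ 2 =
      ENNReal.ofReal (Real.exp (c * τ) ^ 2) * ‖V (Real.exp (-(c * τ)) • y)‖ₑ ^ 2 := by
    intro y
    rw [enorm_smul, mul_pow, Real.enorm_eq_ofReal hm.le, ← ENNReal.ofReal_pow hm.le]
  simp_rw [h1]
  rw [lintegral_const_mul' _ _ ENNReal.ofReal_ne_top,
    lintegral_ball_comp_smul (fun x => ‖V x‖ₑ ^ 2) hd a, ← mul_assoc, ← ENNReal.ofReal_mul (by positivity)]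
  congr 2
  rw [← Real.exp_nat_mul, ← Real.exp_nat_mul, ← Real.exp_neg, ← Real.exp_add]
  congr 1
  push_cast
  ring

/-! ### The `A`-gauge kills breathers expanding into the past -/

/-- **`c' < 0` + `A`-gauge ⇒ the profile has zero energy on every ball.**  If `u(τ, y) = e^{c'τ} V(e^{−c'τ} y)` for `τ < 0` with `c' < 0`
and `a^{2ρ} A(a; 0; u) ≤ c` for all `a > 0` (`ρ ≥ 0`), then `∫_{B_R}‖V‖² = 0` for every `R > 0`: at the admissible slice `τ = s/c'`,
radius `a = R e^{s}` (`s` large: `R² e^{2s}(−c') > s` makes `τ > −a²`), `∫_{B_R}‖V‖² ≤ c R^{1−2ρ} e^{−(4+2ρ)s} → 0`. [folklore] -/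
theorem lintegral_ball_profile_eq_zero_of_gaugeA {ρ : ℝ} (hρ : 0 ≤ ρ)
    {u : ℝ → EuclideanSpace ℝ (Fin 3) → EuclideanSpace ℝ (Fin 3)} {c : ℝ≥0}
    (hA : ∀ a : ℝ, 0 < a → ENNReal.ofReal (a ^ (2 * ρ)) *
      cknA a (0 : ℝ × EuclideanSpace ℝ (Fin 3)) u ≤ (c : ℝ≥0∞))
    {c' : ℝ} (hc' : c' < 0) {V : EuclideanSpace ℝ (Fin 3) → EuclideanSpace ℝ (Fin 3)}
    (hbr : ∀ τ : ℝ, τ < 0 → ∀ y : EuclideanSpace ℝ (Fin 3),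
      u τ y = Real.exp (c' * τ) • V (Real.exp (-(c' * τ)) • y))
    {R : ℝ} (hR : 0 < R) :
    ∫⁻ x in ball (0 : EuclideanSpace ℝ (Fin 3)) R, ‖V x‖ₑ ^ 2 = 0 := by
  set J : ℝ≥0∞ := ∫⁻ x in ball (0 : EuclideanSpace ℝ (Fin 3)) R, ‖V x‖ₑ ^ 2 with hJ
  have hc'0 : 0 < -c' := neg_pos.2 hc'
  have h42 : (0 : ℝ) < 4 + 2 * ρ := by linarith
  -- ### the bound at the admissible slice `τ = s / c'`, for every large `s`
  have hbound : ∀ s : ℝ, 1 / ((-c') * R ^ 2) ≤ s → 0 < s →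
      J ≤ ENNReal.ofReal (R ^ (1 - 2 * ρ) * Real.exp (-((4 + 2 * ρ) * s))) * (c : ℝ≥0∞) := by
    intro s hs1 hs0
    set τ : ℝ := s / c' with hτdef
    have hcτ : c' * τ = s := by rw [hτdef]; exact mul_div_cancel₀ s hc'.ne
    have hτ0 : τ < 0 := div_neg_of_pos_of_neg hs0 hc'
    set a : ℝ := R * Real.exp s with hadef
    have hes : 0 < Real.exp s := Real.exp_pos _
    have ha0 : 0 < a := mul_pos hR hes
    -- admissibility `−a² < τ`: `R² e^{2s} (−c') > s`
    have hadm : -(a ^ 2) < τ := by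
      have h1 : (1 + s) ≤ Real.exp s := by linarith [Real.add_one_le_exp s]
      have h2 : s ^ 2 < Real.exp s ^ 2 := by nlinarith
      have h3 : s ≤ (-c') * R ^ 2 * s ^ 2 := by
        have : 1 ≤ (-c') * R ^ 2 * s := by
          rw [div_le_iff₀ (by positivity)] at hs1; linarith
        nlinarith
      have h4 : s < (-c') * (a ^ 2) := by
        rw [hadef, mul_pow, ← Real.exp_nat_mul]
        have : (-c') * R ^ 2 * s ^ 2 < (-c') * R ^ 2 * Real.exp s ^ 2 :=
          mul_lt_mul_of_pos_left h2 (by positivity)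
        rw [Real.exp_nat_mul]
        nlinarith
      rw [hτdef, div_eq_mul_inv]
      have hci : c'⁻¹ < 0 := inv_lt_zero.2 hc'
      nlinarith [mul_inv_cancel₀ hc'.ne]
    have hτI : τ ∈ Ioo ((0 : ℝ × EuclideanSpace ℝ (Fin 3)).1 - a ^ 2) (0 : ℝ × EuclideanSpace ℝ (Fin 3)).1 := by
      simp only [Prod.fst_zero, zero_sub, mem_Ioo]
      exact ⟨hadm, hτ0⟩
    -- the gauge on the slice
    have hslice : (ENNReal.ofReal a)⁻¹ * ∫⁻ x in ball (0 : EuclideanSpace ℝ (Fin 3)) a, ‖u τ x‖ₑ ^ 2 ≤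
        cknA a (0 : ℝ × EuclideanSpace ℝ (Fin 3)) u := by
      unfold cknA
      exact le_iSup₂ (f := fun t (_ : t ∈ Ioo ((0 : ℝ × EuclideanSpace ℝ (Fin 3)).1 - a ^ 2)
          (0 : ℝ × EuclideanSpace ℝ (Fin 3)).1) =>
          (ENNReal.ofReal a)⁻¹ * ∫⁻ x in ball (0 : ℝ × EuclideanSpace ℝ (Fin 3)).2 a, ‖u t x‖ₑ ^ 2) τ hτI
    set I : ℝ≥0∞ := ∫⁻ x in ball (0 : EuclideanSpace ℝ (Fin 3)) a, ‖u τ x‖ₑ ^ 2 with hI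
    have hgauge : ENNReal.ofReal (a ^ (2 * ρ)) * ((ENNReal.ofReal a)⁻¹ * I) ≤ (c : ℝ≥0∞) :=
      calc ENNReal.ofReal (a ^ (2 * ρ)) * ((ENNReal.ofReal a)⁻¹ * I)
          ≤ ENNReal.ofReal (a ^ (2 * ρ)) * cknA a (0 : ℝ × EuclideanSpace ℝ (Fin 3)) u := by gcongr
        _ ≤ (c : ℝ≥0∞) := hA a ha0
    have hKa : ENNReal.ofReal (a ^ (2 * ρ)) * (ENNReal.ofReal a)⁻¹ = ENNReal.ofReal (a ^ (2 * ρ - 1)) := by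
      rw [← ENNReal.ofReal_inv_of_pos ha0, ← ENNReal.ofReal_mul (by positivity), Real.rpow_sub_one ha0.ne',
        div_eq_mul_inv]
    have hIle : I ≤ ENNReal.ofReal (a ^ (1 - 2 * ρ)) * (c : ℝ≥0∞) := by
      have hunit : ENNReal.ofReal (a ^ (1 - 2 * ρ)) * ENNReal.ofReal (a ^ (2 * ρ - 1)) = 1 := by
        rw [← ENNReal.ofReal_mul (by positivity), ← Real.rpow_add ha0, show (1 - 2 * ρ) + (2 * ρ - 1) = 0 by ring,
          Real.rpow_zero, ENNReal.ofReal_one]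
      calc I = ENNReal.ofReal (a ^ (1 - 2 * ρ)) * (ENNReal.ofReal (a ^ (2 * ρ - 1)) * I) := by
            rw [← mul_assoc, hunit, one_mul]
        _ = ENNReal.ofReal (a ^ (1 - 2 * ρ)) * (ENNReal.ofReal (a ^ (2 * ρ)) * ((ENNReal.ofReal a)⁻¹ * I)) := by
            rw [← mul_assoc (ENNReal.ofReal (a ^ (2 * ρ))), hKa]
        _ ≤ ENNReal.ofReal (a ^ (1 - 2 * ρ)) * (c : ℝ≥0∞) := by gcongr
    -- the slice energy in profile variables: `I = e^{5s} J`
    have hIeq : I = ENNReal.ofReal (Real.exp (5 * (c' * τ))) * J := by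
      have hfun : (fun x => ‖u τ x‖ₑ ^ 2) =
          fun x => ‖Real.exp (c' * τ) • V (Real.exp (-(c' * τ)) • x)‖ₑ ^ 2 := by
        funext x; rw [hbr τ hτ0 x]
      have hrad : Real.exp (-s) * a = R := by
        rw [hadef, mul_left_comm, ← Real.exp_add, show -s + s = 0 by ring, Real.exp_zero, mul_one]
      rw [hI, hfun, lintegral_ball_enorm_sq_breatherSlice, hcτ, hrad]
    -- assemble: `J ≤ e^{−5s} a^{1−2ρ} c = R^{1−2ρ} e^{−(4+2ρ)s} c`
    have hE5 : ENNReal.ofReal (Real.exp (-(5 * s))) * ENNReal.ofReal (Real.exp (5 * (c' * τ))) = 1 := by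
      rw [← ENNReal.ofReal_mul (Real.exp_pos _).le, ← Real.exp_add, hcτ, show -(5 * s) + 5 * s = 0 by ring,
        Real.exp_zero, ENNReal.ofReal_one]
    have hpow : Real.exp (-(5 * s)) * a ^ (1 - 2 * ρ) = R ^ (1 - 2 * ρ) * Real.exp (-((4 + 2 * ρ) * s)) := by
      rw [hadef, Real.mul_rpow hR.le hes.le, ← Real.exp_mul,
        show Real.exp (-(5 * s)) * (R ^ (1 - 2 * ρ) * Real.exp (s * (1 - 2 * ρ))) =
          R ^ (1 - 2 * ρ) * (Real.exp (-(5 * s)) * Real.exp (s * (1 - 2 * ρ))) by ring,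
        ← Real.exp_add, show -(5 * s) + s * (1 - 2 * ρ) = -((4 + 2 * ρ) * s) by ring]
    calc J = ENNReal.ofReal (Real.exp (-(5 * s))) * (ENNReal.ofReal (Real.exp (5 * (c' * τ))) * J) := by
          rw [← mul_assoc, hE5, one_mul]
      _ = ENNReal.ofReal (Real.exp (-(5 * s))) * I := by rw [hIeq]
      _ ≤ ENNReal.ofReal (Real.exp (-(5 * s))) * (ENNReal.ofReal (a ^ (1 - 2 * ρ)) * (c : ℝ≥0∞)) := by gcongr
      _ = ENNReal.ofReal (R ^ (1 - 2 * ρ) * Real.exp (-((4 + 2 * ρ) * s))) * (c : ℝ≥0∞) := by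
          rw [← mul_assoc, ← ENNReal.ofReal_mul (Real.exp_pos _).le, hpow]
  -- ### `s → ∞`
  refine le_antisymm (ENNReal.le_of_forall_pos_le_add fun δ hδ _ => ?_) zero_le
  rw [zero_add]
  have htend : Tendsto (fun s : ℝ => (c : ℝ) * (R ^ (1 - 2 * ρ) * Real.exp (-((4 + 2 * ρ) * s)))) atTop
      (𝓝 ((c : ℝ) * (R ^ (1 - 2 * ρ) * 0))) := by
    refine tendsto_const_nhds.mul (tendsto_const_nhds.mul ?_)
    exact Real.tendsto_exp_neg_atTop_nhds_zero.comp (tendsto_id.const_mul_atTop h42)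
  rw [mul_zero, mul_zero] at htend
  have hδ' : (0 : ℝ) < δ := by exact_mod_cast hδ
  obtain ⟨s, hsδ, hsge⟩ := ((htend.eventually (gt_mem_nhds hδ')).and
    (eventually_ge_atTop (max (1 / ((-c') * R ^ 2)) 1))).exists
  have hs1 : 1 / ((-c') * R ^ 2) ≤ s := (le_max_left _ _).trans hsge
  have hs0 : 0 < s := lt_of_lt_of_le one_pos ((le_max_right _ _).trans hsge)
  calc J ≤ ENNReal.ofReal (R ^ (1 - 2 * ρ) * Real.exp (-((4 + 2 * ρ) * s))) * (c : ℝ≥0∞) := hbound s hs1 hs0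
    _ = ENNReal.ofReal ((c : ℝ) * (R ^ (1 - 2 * ρ) * Real.exp (-((4 + 2 * ρ) * s)))) := by
        have hc0 : (0 : ℝ) ≤ c := c.2
        rw [ENNReal.ofReal_mul hc0, ENNReal.ofReal_coe_nnreal, mul_comm]
    _ ≤ (δ : ℝ≥0∞) := by
        rw [← ENNReal.ofReal_coe_nnreal]; exact ENNReal.ofReal_le_ofReal hsδ.le

/-- **LOG-TIME BREATHERS EXPANDING INTO THE PAST ARE TRIVIAL** (crux hypotheses verbatim — suitable weak Euler pair on the slab, weak
gradient, the three power gauges —, any `ρ ≥ 0`): if `u(τ, y) = e^{c'τ} V(e^{−c'τ} y)` for all `τ < 0` with `c' < 0`, then `u = 0` a.e. on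
`(−∞,0) × ℝ³`.  (`∫_{B_R}‖V‖² = 0` for every `R` by `lintegral_ball_profile_eq_zero_of_gaugeA`; hence every slice `u(τ)` has zero energy —
countable subadditivity over balls, no measurability of `V` needed —; the past is energy-quiescent and the crux's filled stratum
`ae_eq_zero_of_gauge_of_energyVanishing_allRho` concludes.)  This is `Sig.stub_pastExpandingBreather` of the line `logtime-breathers`
(ns-idea-11) with `InClass`, `IsLogtimeBreather`, `VanishesAE` unfolded. [folklore] -/
theorem ae_eq_zero_of_gauge_of_pastExpandingBreather {ρ : ℝ} (hρ : 0 ≤ ρ)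
    {u : ℝ → EuclideanSpace ℝ (Fin 3) → EuclideanSpace ℝ (Fin 3)} {p : ℝ → EuclideanSpace ℝ (Fin 3) → ℝ}
    {H : ℝ → EuclideanSpace ℝ (Fin 3) → EuclideanSpace ℝ (Fin 3) →L[ℝ] EuclideanSpace ℝ (Fin 3)} {c : ℝ≥0}
    (hsw : IsSuitableWeakSolutionOn (slab (EuclideanSpace ℝ (Fin 3)) (Iio 0) isOpen_Iio) 0 0 u p)
    (hH : HasWeakSpatialGradientOn (slab (EuclideanSpace ℝ (Fin 3)) (Iio 0) isOpen_Iio) u H)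
    (hgauge : ∀ a : ℝ, 0 < a →
      ENNReal.ofReal (a ^ (2 * ρ)) * cknA a (0 : ℝ × EuclideanSpace ℝ (Fin 3)) u +
          ENNReal.ofReal (a ^ ρ) * cknE a (0 : ℝ × EuclideanSpace ℝ (Fin 3)) H +
        ENNReal.ofReal (a ^ (2 * ρ)) * cknD a (0 : ℝ × EuclideanSpace ℝ (Fin 3)) p ≤ (c : ℝ≥0∞))
    {c' : ℝ} (hc' : c' < 0) {V : EuclideanSpace ℝ (Fin 3) → EuclideanSpace ℝ (Fin 3)}
    (hbr : ∀ τ : ℝ, τ < 0 → ∀ y : EuclideanSpace ℝ (Fin 3),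
      u τ y = Real.exp (c' * τ) • V (Real.exp (-(c' * τ)) • y)) :
    uncurry u =ᵐ[volume.restrict (Iio (0 : ℝ) ×ˢ (univ : Set (EuclideanSpace ℝ (Fin 3))))] 0 := by
  have hA : ∀ a : ℝ, 0 < a → ENNReal.ofReal (a ^ (2 * ρ)) *
      cknA a (0 : ℝ × EuclideanSpace ℝ (Fin 3)) u ≤ (c : ℝ≥0∞) :=
    fun a ha => le_trans (le_trans le_self_add le_self_add) (hgauge a ha)
  have hball : ∀ R : ℝ, 0 < R → ∫⁻ x in ball (0 : EuclideanSpace ℝ (Fin 3)) R, ‖V x‖ₑ ^ 2 = 0 :=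
    fun R hR => lintegral_ball_profile_eq_zero_of_gaugeA hρ hA hc' hbr hR
  -- ### every slice has zero energy
  have hslice0 : ∀ s : ℝ, s < 0 → ∫⁻ x, ‖u s x‖ₑ ^ 2 = 0 := by
    intro s hs
    have hd : 0 < Real.exp (-(c' * s)) := Real.exp_pos _
    have hballs : ∀ n : ℕ, ∫⁻ x in ball (0 : EuclideanSpace ℝ (Fin 3)) ((n : ℝ) + 1), ‖u s x‖ₑ ^ 2 = 0 := by
      intro n
      have hfun : (fun x => ‖u s x‖ₑ ^ 2) =
          fun x => ‖Real.exp (c' * s) • V (Real.exp (-(c' * s)) • x)‖ₑ ^ 2 := by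
        funext x; rw [hbr s hs x]
      rw [hfun, lintegral_ball_enorm_sq_breatherSlice, hball _ (by positivity), mul_zero]
    have hunion : (⋃ n : ℕ, ball (0 : EuclideanSpace ℝ (Fin 3)) ((n : ℝ) + 1)) = univ := by
      refine eq_univ_of_forall fun y => mem_iUnion.2 ?_
      obtain ⟨n, hn⟩ := exists_nat_gt ‖y‖
      exact ⟨n, by rw [mem_ball, dist_zero_right]; linarith⟩
    refine le_antisymm ?_ zero_le
    calc ∫⁻ x, ‖u s x‖ₑ ^ 2
        = ∫⁻ x in (⋃ n : ℕ, ball (0 : EuclideanSpace ℝ (Fin 3)) ((n : ℝ) + 1)), ‖u s x‖ₑ ^ 2 := by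
          rw [hunion, Measure.restrict_univ]
      _ ≤ ∑' n : ℕ, ∫⁻ x in ball (0 : EuclideanSpace ℝ (Fin 3)) ((n : ℝ) + 1), ‖u s x‖ₑ ^ 2 :=
          lintegral_iUnion_le _ _
      _ = 0 := by simp [hballs]
  -- ### the energy-quiescent past
  refine ae_eq_zero_of_gauge_of_energyVanishing_allRho hρ hsw hH hgauge fun ε hε N => ?_
  have hsub : Iio (min (-N) 0) ⊆ {s : ℝ | s < -N ∧ ∫⁻ x, ‖u s x‖ₑ ^ 2 ≤ ENNReal.ofReal ε} := by
    intro s hs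
    rw [mem_Iio, lt_min_iff] at hs
    refine ⟨hs.1, ?_⟩
    rw [hslice0 s hs.2]
    exact zero_le
  have hinf : volume (Iio (min (-N) 0)) = (⊤ : ℝ≥0∞) := Real.volume_Iio
  intro h0
  have := measure_mono_null hsub h0
  rw [hinf] at this
  exact ENNReal.top_ne_zero this

end LogtimeBreather

end Summit.NavierStokesRegularity.NavierStokesRegularity.Theorems.PowerGaugeEulerLiouville
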